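import Mathlib
import Literature.AlgebraicGeometry.Resolution.ExcellentRings
import Literature.AlgebraicGeometry.Resolution.RegularHomComposition
import Literature.AlgebraicGeometry.Resolution.RegularHomReduced
import Literature.AlgebraicGeometry.Resolution.ArtinApproximationAffineLemmas
import HarnessLib

/-!
# Crux `Steer` (stmt-ResolutionOfSingularities-16345), line `switching_dichotomy` — a normal local G-ring is FROBENIUS-CLOSED in its completion

Helper for piece K(1) (`∀ p prime, NoEternalIsolatedRadicandChain p 1`) of the σ-line of chain
W4.1 (res-L0-w41-plan-1, `CRUX-PLAN-Steer-v3-R2.md`; K(1) owner res-D-pv-011 AS res-L0-w41-stub-7,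
plan (a)–(d) of 2026-08-27T04:48:15Z; this file is piece (c)). OURS — statements about the route's
own objects; nothing here is a statement of the manuscript under review.

**The fact.** Let `S` be a Noetherian local domain which is integrally closed, of prime
characteristic `p`, and whose completion map `S → Ŝ = AdicCompletion 𝔪 S` is a REGULAR
homomorphism (the G-ring clause of excellence, read at the maximal ideal). If `f ∈ S` becomes a
`p`-th power in `Ŝ`, then `f` is already a `p`-th power in `S`
(`exists_pow_eq_of_pow_eq_adicCompletion`). In particular, if `f` is a `p`-th power modulo `𝔪ⁿ`
along an `𝔪`-adic Cauchy sequence of approximants, then `f ∈ S^p`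
(`exists_pow_eq_of_adicCauchy`); wrappers from `IsGRing S` / `IsExcellentRing S`
(`…_of_isGRing`, `…_of_isExcellentRing`).

**Proof (no field extension needed).** If `f ∉ S^p` then `g := X^p − f` is PRIME in `S[X]`
(`prime_X_pow_sub_C_of_forall_pow_ne`: `f ∉ Frac(S)^p` by integral closedness, Kummer
irreducibility over `Frac S`, and Gauss `Monic.dvd_iff`/`map_dvd_map` for primality), so
`A' := S[X]/(g)` is a reduced Noetherian finite `S`-algebra. Regular homomorphisms are stable under
finite base change (`IsRegularHom.baseChange_of_quasiFinite`, Matsumura Thm. 32.1 proof) and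
reducedness ascends along them (`IsRegularHom.isReduced`, Stacks 07QK), so `A' ⊗_S Ŝ` is reduced.
But if `b^p = f` in `Ŝ`, the element `θ := 1 ⊗ t − b ⊗ 1` of `Ŝ ⊗_S A'` satisfies
`θ^p = 1 ⊗ f − f ⊗ 1 = 0` while its coordinate at the basis vector `1 ⊗ t` of the free
`Ŝ`-module `Ŝ ⊗_S A'` (power basis of `A'`) is `1 ≠ 0` — a non-zero nilpotent. Contradiction.

This is the classical «`F ∩ F̂^p = F^p` for an excellent DVR» (the failure of which is the
standard non-excellent DVR in characteristic `p`), in the form K(1) consumes.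
-/

-- The namespace mirrors the chain's helper layout (`…Theorems.SwitchingDichotomy.<Piece>`) on purpose.
set_option linter.dupNamespace false

noncomputable section

namespace Summit.ResolutionOfSingularities.ResolutionOfSingularities.Theorems.SwitchingDichotomy.CompletionFrobeniusClosed

open Polynomial IsLocalRing TensorProduct
open Literature.AlgebraicGeometry.Resolution (IsRegularHom IsGRing IsExcellentRing)

universe u

variable {S : Type u} [CommRing S]

/-- **`X^p − f` is prime when `f` is not a `p`-th power** (over an integrally closed domain `S`,
`p` prime): `f` is not a `p`-th power in `Frac S` either (a `p`-th root would be integral over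
`S`), so `X^p − f` is irreducible over `Frac S` (Kummer), and a monic polynomial over an
integrally closed domain divides in `S[X]` iff it divides in `Frac(S)[X]`. [folklore] -/
theorem prime_X_pow_sub_C_of_forall_pow_ne [IsDomain S] [IsIntegrallyClosed S] {p : ℕ}
    (hp : p.Prime) (f : S) (hf : ∀ a : S, a ^ p ≠ f) : Prime ((X : S[X]) ^ p - C f) := by
  set K := FractionRing S
  set g : S[X] := X ^ p - C f with hg_def
  have hg : g.Monic := monic_X_pow_sub_C f hp.ne_zero
  have hinj : Function.Injective (algebraMap S K) := IsFractionRing.injective S K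
  -- `f` is not a `p`-th power in `K`
  have hfK : ∀ b : K, b ^ p ≠ algebraMap S K f := by
    intro b hb
    have hint : IsIntegral S b := by
      refine ⟨g, hg, ?_⟩
      simp [hg_def, eval₂_sub, eval₂_X_pow, eval₂_C, hb]
    obtain ⟨a, ha⟩ := IsIntegrallyClosed.isIntegral_iff.mp hint
    refine hf a (hinj ?_)
    rw [map_pow, ha, hb]
  have hirrK : Irreducible (g.map (algebraMap S K)) := by
    rw [hg_def, Polynomial.map_sub, Polynomial.map_pow, map_X, map_C]
    exact X_pow_sub_C_irreducible_of_prime hp hfK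
  have hprimeK : Prime (g.map (algebraMap S K)) := hirrK.prime
  refine ⟨hg.ne_zero, fun hu => ?_, fun a b hab => ?_⟩
  · have h1 : g = 1 := hg.isUnit_iff.mp hu
    have h := congrArg natDegree h1
    rw [hg_def, natDegree_X_pow_sub_C, natDegree_one] at h
    exact hp.ne_zero h
  · have hab' : g.map (algebraMap S K) ∣ a.map (algebraMap S K) * b.map (algebraMap S K) := by
      rw [← Polynomial.map_mul]
      exact Polynomial.map_dvd _ hab
    rcases hprimeK.2.2 _ _ hab' with h | h
    · exact Or.inl ((map_dvd_map _ hinj hg).mp h)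
    · exact Or.inr ((map_dvd_map _ hinj hg).mp h)

/-- **A normal local G-ring is Frobenius-closed in its completion.** Let `S` be an integrally
closed Noetherian local domain of prime characteristic `p` such that `S → Ŝ` is a regular
homomorphism (`Ŝ` the `𝔪`-adic completion). If `f ∈ S` is a `p`-th power in `Ŝ`, then `f` is a
`p`-th power in `S`. OURS. [cite: Matsumura1987, Thm. 32.1 (i), proof, p. 257]
[cite: StacksProject, Tag 07QK] -/
theorem exists_pow_eq_of_pow_eq_adicCompletion [IsDomain S] [IsNoetherianRing S] [IsLocalRing S]
    [IsIntegrallyClosed S] (p : ℕ) [Fact p.Prime] [CharP S p]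
    (hreg : IsRegularHom S (AdicCompletion (maximalIdeal S) S))
    (f : S) (b : AdicCompletion (maximalIdeal S) S)
    (hb : b ^ p = algebraMap S (AdicCompletion (maximalIdeal S) S) f) :
    ∃ a : S, a ^ p = f := by
  have hp : p.Prime := Fact.out
  by_contra hne
  push Not at hne
  set g : S[X] := X ^ p - C f with hg_def
  have hg : g.Monic := monic_X_pow_sub_C f hp.ne_zero
  have hprime : Prime g := prime_X_pow_sub_C_of_forall_pow_ne hp f hne
  haveI : IsDomain (AdjoinRoot g) := AdjoinRoot.isDomain_of_prime hprime
  haveI : Module.Finite S (AdjoinRoot g) := hg.finite_adjoinRoot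
  haveI : Module.Free S (AdjoinRoot g) := hg.free_adjoinRoot
  -- the base change `A' → A' ⊗ Ŝ` of the completion map is regular, so `A' ⊗ Ŝ` is reduced
  have hreg' : IsRegularHom (AdjoinRoot g) (AdjoinRoot g ⊗[S] (AdicCompletion (maximalIdeal S) S)) :=
    hreg.baseChange_of_quasiFinite (AdjoinRoot g)
  haveI hred : IsReduced (AdjoinRoot g ⊗[S] (AdicCompletion (maximalIdeal S) S)) := hreg'.isReduced
  -- work in `T := Ŝ ⊗ A'`, free over `Ŝ` on the power basis of `A'`
  haveI hredT : IsReduced ((AdicCompletion (maximalIdeal S) S) ⊗[S] AdjoinRoot g) :=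
    isReduced_of_injective (Algebra.TensorProduct.comm S (AdicCompletion (maximalIdeal S) S) (AdjoinRoot g))
      (Algebra.TensorProduct.comm S (AdicCompletion (maximalIdeal S) S) (AdjoinRoot g)).injective
  set pb : PowerBasis S (AdjoinRoot g) := AdjoinRoot.powerBasis' hg with hpb
  have hdim : pb.dim = p := by
    rw [hpb, AdjoinRoot.powerBasis'_dim, hg_def, natDegree_X_pow_sub_C]
  set B := Algebra.TensorProduct.basis (AdicCompletion (maximalIdeal S) S) pb.basis with hB
  have h1p : 1 < pb.dim := hdim ▸ hp.one_lt
  have h0p : 0 < pb.dim := lt_trans zero_lt_one h1p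
  set i₀ : Fin pb.dim := ⟨0, h0p⟩
  set i₁ : Fin pb.dim := ⟨1, h1p⟩
  have hi : i₀ ≠ i₁ := by
    intro h
    have := congrArg Fin.val h
    simp [i₀, i₁] at this
  have hB0 : B i₀ = 1 := by
    rw [hB, Algebra.TensorProduct.basis_apply, PowerBasis.coe_basis]
    simp [i₀, Algebra.TensorProduct.one_def]
  have hB1 : B i₁ = 1 ⊗ₜ AdjoinRoot.root g := by
    rw [hB, Algebra.TensorProduct.basis_apply, PowerBasis.coe_basis]
    simp [i₁, hpb, AdjoinRoot.powerBasis'_gen]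
  -- the element `θ = 1 ⊗ t − b ⊗ 1`
  set θ : (AdicCompletion (maximalIdeal S) S) ⊗[S] AdjoinRoot g := 1 ⊗ₜ AdjoinRoot.root g - b ⊗ₜ 1 with hθ_def
  have hθ : θ = B i₁ - b • B i₀ := by
    rw [hB1, hB0, hθ_def, Algebra.TensorProduct.one_def, TensorProduct.smul_tmul', smul_eq_mul,
      mul_one]
  -- its coordinate at `i₁` is `1`, so `θ ≠ 0`
  have hθne : θ ≠ 0 := by
    intro h0
    have h := congrArg (fun x => B.repr x i₁) h0
    simp only [hθ, map_sub, map_smul, Module.Basis.repr_self, Finsupp.sub_apply,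
      Finsupp.smul_apply, Finsupp.single_eq_same, Finsupp.single_apply, if_neg hi, smul_zero,
      sub_zero, map_zero, Finsupp.coe_zero, Pi.zero_apply] at h
    exact one_ne_zero h
  haveI : Nontrivial ((AdicCompletion (maximalIdeal S) S) ⊗[S] AdjoinRoot g) := ⟨⟨θ, 0, hθne⟩⟩
  haveI : CharP ((AdicCompletion (maximalIdeal S) S) ⊗[S] AdjoinRoot g) p := by
    let φ : ZMod p →+* (AdicCompletion (maximalIdeal S) S) ⊗[S] AdjoinRoot g :=
      (algebraMap S ((AdicCompletion (maximalIdeal S) S) ⊗[S] AdjoinRoot g)).comp (ZMod.castHom (dvd_refl p) S)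
    exact (φ.charP_iff_charP p).mp inferInstance
  -- `t^p = f` in `A'`
  have hroot : AdjoinRoot.root g ^ p = algebraMap S (AdjoinRoot g) f := by
    have h := AdjoinRoot.eval₂_root g
    rw [hg_def, eval₂_sub, eval₂_X_pow, eval₂_C, sub_eq_zero] at h
    rw [h, AdjoinRoot.algebraMap_eq]
  -- `θ^p = 1 ⊗ f − f ⊗ 1 = 0`
  have hθp : θ ^ p = 0 := by
    rw [hθ_def, sub_pow_char, Algebra.TensorProduct.tmul_pow, Algebra.TensorProduct.tmul_pow, one_pow,
      one_pow, hb, hroot, ← Algebra.TensorProduct.algebraMap_apply' (R := S),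
      ← Algebra.TensorProduct.algebraMap_apply (R := S), sub_self]
  exact hθne (IsReduced.eq_zero θ ⟨p, hθp⟩)

/-- A local ring is its own localisation at the maximal ideal. [folklore] -/
theorem isLocalization_atPrime_maximalIdeal_self (S : Type u) [CommRing S] [IsLocalRing S] :
    IsLocalization.AtPrime S (maximalIdeal S) :=
  IsLocalization.self fun x hx => by
    have hx' : x ∉ maximalIdeal S := hx
    rwa [mem_maximalIdeal, mem_nonunits_iff, not_not] at hx'

/-- **G-ring form.** For an integrally closed local domain `S` of prime characteristic `p` which
is a G-ring (formal fibres geometrically regular), an element of `S` that is a `p`-th power in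
the completion `Ŝ` is a `p`-th power in `S`. OURS. [cite: Matsumura1987, §32 p. 256] -/
theorem exists_pow_eq_of_pow_eq_adicCompletion_of_isGRing [IsDomain S] [IsLocalRing S]
    [IsIntegrallyClosed S] (hS : IsGRing S) (p : ℕ) [Fact p.Prime] [CharP S p]
    (f : S) (b : AdicCompletion (maximalIdeal S) S)
    (hb : b ^ p = algebraMap S (AdicCompletion (maximalIdeal S) S) f) :
    ∃ a : S, a ^ p = f := by
  haveI : IsNoetherianRing S := hS.1
  haveI : IsLocalization.AtPrime S (maximalIdeal S) := isLocalization_atPrime_maximalIdeal_self S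
  exact exists_pow_eq_of_pow_eq_adicCompletion p
    (IsGRing.isRegularHom_completion_of_isLocalization_atPrime hS (maximalIdeal S) S) f b hb

/-- **Cauchy-sequence form** (the shape K(1) consumes): if `a : ℕ → S` is an `𝔪`-adic Cauchy
sequence (`a n ≡ a (n+1) mod 𝔪ⁿ`) with `(a n)^p ≡ f mod 𝔪ⁿ` for every `n`, and `S → Ŝ` is a
regular homomorphism (`S` an integrally closed Noetherian local domain of characteristic `p`),
then `f` is a `p`-th power in `S`. OURS. [folklore] -/
theorem exists_pow_eq_of_adicCauchy [IsDomain S] [IsNoetherianRing S] [IsLocalRing S]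
    [IsIntegrallyClosed S] (p : ℕ) [Fact p.Prime] [CharP S p]
    (hreg : IsRegularHom S (AdicCompletion (maximalIdeal S) S))
    (f : S) (a : ℕ → S) (ha : ∀ n, a n - a (n + 1) ∈ maximalIdeal S ^ n)
    (hfa : ∀ n, a n ^ p - f ∈ maximalIdeal S ^ n) : ∃ c : S, c ^ p = f := by
  set I := maximalIdeal S
  have hc : ∀ n, a n ≡ a (n + 1) [SMOD (I ^ n • ⊤ : Submodule S S)] := fun n => by
    rw [SModEq.sub_mem, smul_eq_mul, Ideal.mul_top]
    exact ha n
  let seq : AdicCompletion.AdicCauchySequence I S := AdicCompletion.AdicCauchySequence.mk I S a hc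
  refine exists_pow_eq_of_pow_eq_adicCompletion p hreg f (AdicCompletion.mkₐ I seq) ?_
  refine AdicCompletion.ext_evalₐ fun n => ?_
  rw [map_pow, AdicCompletion.evalₐ_mkₐ, AdicCompletion.algebraMap_apply,
    AdicCompletion.evalₐ_of, ← map_pow, Ideal.Quotient.eq]
  exact hfa n

/-- **Cauchy-sequence form for G-rings** (e.g. excellent rings): `S` an integrally closed local
domain of prime characteristic `p` with `IsGRing S`; an `𝔪`-adically convergent sequence of
`p`-th powers with limit `f` forces `f ∈ S^p`. OURS. [cite: Matsumura1987, §32 p. 256] -/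
theorem exists_pow_eq_of_adicCauchy_of_isGRing [IsDomain S] [IsLocalRing S] [IsIntegrallyClosed S]
    (hS : IsGRing S) (p : ℕ) [Fact p.Prime] [CharP S p]
    (f : S) (a : ℕ → S) (ha : ∀ n, a n - a (n + 1) ∈ maximalIdeal S ^ n)
    (hfa : ∀ n, a n ^ p - f ∈ maximalIdeal S ^ n) : ∃ c : S, c ^ p = f := by
  haveI : IsNoetherianRing S := hS.1
  haveI : IsLocalization.AtPrime S (maximalIdeal S) := isLocalization_atPrime_maximalIdeal_self S
  exact exists_pow_eq_of_adicCauchy p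
    (IsGRing.isRegularHom_completion_of_isLocalization_atPrime hS (maximalIdeal S) S) f a ha hfa

/-- **Excellent form.** An excellent, integrally closed local domain `S` of prime characteristic
`p` is Frobenius-closed in its completion along `𝔪`-adic Cauchy sequences: if `(a n)^p → f`
`𝔪`-adically with `(a n)` Cauchy, then `f = c^p` for some `c ∈ S`. (For a DVR this is the
classical «`F ∩ F̂^p = F^p`».) OURS. [cite: Matsumura1987, §32 p. 260 Definition] -/
theorem exists_pow_eq_of_adicCauchy_of_isExcellentRing [IsDomain S] [IsLocalRing S]
    [IsIntegrallyClosed S] (hS : IsExcellentRing S) (p : ℕ) [Fact p.Prime] [CharP S p]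
    (f : S) (a : ℕ → S) (ha : ∀ n, a n - a (n + 1) ∈ maximalIdeal S ^ n)
    (hfa : ∀ n, a n ^ p - f ∈ maximalIdeal S ^ n) : ∃ c : S, c ^ p = f :=
  exists_pow_eq_of_adicCauchy_of_isGRing hS.2.1 p f a ha hfa

end Summit.ResolutionOfSingularities.ResolutionOfSingularities.Theorems.SwitchingDichotomy.CompletionFrobeniusClosed

end
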